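import Summits.ResolutionOfSingularities.ResolutionOfSingularities.Theorems.FrobeniusClosingPatchingRelPerfectDepthPhaseCDetachedCylinder
import Literature.AlgebraicGeometry.Resolution.AlterationsEnlargingZ
import HarnessLib

/-!
# Crux `PatchingRelPerfect` (stmt-ResolutionOfSingularities-16161), chain W5.2 — F7(β) (β-AX) PHASE C,
# REACHABLE FAMILIES (ii): the N3-pocket line game `K = (g) + (g + a bʲ) + (t)` under `V(t, g, b)`

[OURS · L1 W5.2 · F7(β) (β-AX) Phase C · res-L1-w52-plan-1 NAMING G11-7 (1) (T2″) / ANSWER 2026-08-27T16:09:56Z «RUNS»;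
companion of `…DepthPhaseCReachableFamilies` (the `(α₂)` run)] res-L1-w52-stub-2 g5.  Replaces the role of NO printed item;
NOT a statement of the manuscript under review (AI-written, weaker than expert review).  MACHINE CHECK, at ring level over
an ARBITRARY commutative ring, of the pocket run of plan-1 RULING G11-6 (1), re-verified by res-L1-w52-tri-1 v27 Row 3 (kit
j282750 S4.1–4.5) — the REACHABLE configuration stranded by Q7′ (tri-1 v26 R5); nothing is claimed for synthetic germs.

Frame: hosts `H = V(g)` (bare) and `𝓐₂ = V(g + a bʲ)`, N-member the exceptional `V(t)` (exponent `1`), letters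
`(t, g, b, a)` part of a regular system of parameters; as an ideal `K = (t, g, a bʲ)`, `cosupp K = V(t, g, a) ∪ V(t, g, b)`,
both lines admissible as is; the centre of record is **`L_b = V(t, g, b)`** (`pocket_le`, `ν = 1`, both hosts contain it).
Charts: `t ↦ (h)`, `g ↦ (h)` (`pocketT`, `pocketG`), **`b ↦ h · K[j − 1]`** (`pocketB`): the same pocket with `j ↦ j − 1`
and the new exceptional `h` in the slot of `b`; after `j` moves `K = (g) + (g + a) + (t) = (t, g, a)` (`pocket_zero_eq`) and
the STRONG END holds (RULING G11-14 currency, FLAG F1): at every prime of the `b`-chart over the closed point containing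
`t′, g′` the members `b, t′`, BOTH hosts `g′, g′ + a` and the remaining parameters form part of ONE regular system of
parameters (`isRsopPart_pocket_end`, from `isRsopPart_chartFamily_reesChart`).  §2 gives the three chart identities as images
under the Rees chart maps.  `MultiHostState` words: each move has `ν = 1`, host orders `1, 1`, `ord_{L_b} N = 1`, the new
exceptional enters `N` with exponent `0`; the measure datum that drops is the host CONTACT order `j` along `L_a = V(t, g, a)`.

Fact-free; design / termination evidence for X3; no E-side content.

## References
* The Stacks Project, Tags 0804, 0BIQ (affine blow-up algebras and their charts). [StacksProject]
* A. J. de Jong, *Smoothness, semi-stability and alterations*, Publ. Math. IHÉS 83 (1996), 2.4. [DeJong1996]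
-/

-- `Summit.<Summit>.<Sub>.Theorems` with `Sub = Summit` (single-conjunct summit, D-0017)
set_option linter.dupNamespace false

noncomputable section

open IsLocalRing Literature.AlgebraicGeometry.Resolution

namespace Summit.ResolutionOfSingularities.ResolutionOfSingularities.Theorems

universe u

namespace DepthPhaseCRuns

open DepthPhaseC CuspMember

/-- N3-pocket: `K = (g) + (g + a bʲ) + (t)`. -/
local notation3 "Kp3[" t "," g "," a "," b "," j "]" =>
  (Ideal.span {g} ⊔ Ideal.span {g + a * b ^ j} ⊔ Ideal.span {t})

/-! ## §1 The pocket move: legality and the three charts -/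

section Pocket

variable {A : Type u} [CommRing A]

/-- **The pocket move is legal for `j ≥ 1`**: `K ≤ (t, g, b)`. [folklore] -/
theorem pocket_le (t g a b : A) (j : ℕ) : Kp3[t, g, a, b, j + 1] ≤ Ideal.span (Set.range ![t, g, b]) := by
  rw [span_range_vec3]
  refine sup_le (sup_le (le_sup_of_le_left le_sup_right) ?_) (le_sup_of_le_left le_sup_left)
  rw [Ideal.span_singleton_le_iff_mem]
  exact Ideal.add_mem _ (Ideal.mem_sup_left (Ideal.mem_sup_right (Ideal.mem_span_singleton_self g)))
    (Ideal.mem_sup_right (Ideal.mem_span_singleton.mpr ⟨a * b ^ j, by ring⟩))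

/-- **`t`-chart** (`t = h`, `g = h g′`, `b = h b′`): `K ↦ (h)`. [folklore] -/
theorem pocketT (g' a b' h : A) (j : ℕ) : Kp3[h, h * g', a, h * b', j + 1] = Ideal.span {h} :=
  sup_sup_span_eq ⟨g', by ring⟩ ⟨g' + a * h ^ j * b' ^ (j + 1), by ring⟩

/-- **`g`-chart** (`g = h`, `t = h t′`, `b = h b′`): `K ↦ (h)`. [folklore] -/
theorem pocketG (t' a b' h : A) (j : ℕ) : Kp3[h * t', h, a, h * b', j + 1] = Ideal.span {h} :=
  span_sup_sup_eq ⟨1 + a * h ^ j * b' ^ (j + 1), by ring⟩ ⟨t', by ring⟩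

/-- **`b`-chart** (`b = h`, `t = h t′`, `g = h g′`): `K ↦ h · K[j − 1]` — the same pocket with `j ↦ j − 1`. [folklore] -/
theorem pocketB (t' g' a h : A) (j : ℕ) :
    Kp3[h * t', h * g', a, h, j + 1] = Ideal.span {h} * Kp3[t', g', a, h, j] := by
  have e1 : h * g' + a * h ^ (j + 1) = h * (g' + a * h ^ j) := by ring
  rw [e1]
  exact (span_singleton_mul_sup₃ _ _ _ _).symm

/-- At `j = 0` the pocket is `(t, g, a)` as an ideal (hosts `g, g + a`, member `t`). [folklore] -/
theorem pocket_zero_eq (t g a b : A) :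
    Kp3[t, g, a, b, 0] = Ideal.span {g} ⊔ Ideal.span {a} ⊔ Ideal.span {t} := by
  rw [pow_zero, mul_one]
  congr 1
  exact sup_span_singleton_congr (by rw [add_sub_cancel_right]; exact Ideal.mem_span_singleton_self g)

end Pocket

/-! ## §2 The pocket move on the Rees charts of `Bl_{(t,g,b)}` -/

section PocketCharts

variable {R : Type u} [CommRing R] (t g a b : R)

local notation3 "cc" => (![t, g, b] : Fin 3 → R)

set_option maxHeartbeats 400000 in
-- instance-path defeq through `HomogeneousLocalization`'s standalone `Pow`/`Mul`
/-- **`t`-chart**: `K B = (t)`. [cite: StacksProject, Tag 0804] -/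
theorem map_pocket_zero (j : ℕ) : (Kp3[t, g, a, b, j + 1]).map (chartBase cc 0) = Ideal.span {chartBase cc 0 t} := by
  have cg : chartBase cc 0 g = chartBase cc 0 t * chartGen cc 0 1 := reesChartBase_apply_eq_mul_chartGen cc 0 1
  have cb : chartBase cc 0 b = chartBase cc 0 t * chartGen cc 0 2 := reesChartBase_apply_eq_mul_chartGen cc 0 2
  rw [map_sup₃, map_add, map_mul, map_pow, cg, cb]
  exact pocketT _ _ _ _ j

set_option maxHeartbeats 400000 in
-- instance-path defeq through `HomogeneousLocalization`'s standalone `Pow`/`Mul`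
/-- **`g`-chart**: `K B = (g)`. [cite: StacksProject, Tag 0804] -/
theorem map_pocket_one (j : ℕ) : (Kp3[t, g, a, b, j + 1]).map (chartBase cc 1) = Ideal.span {chartBase cc 1 g} := by
  have ct : chartBase cc 1 t = chartBase cc 1 g * chartGen cc 1 0 := reesChartBase_apply_eq_mul_chartGen cc 1 0
  have cb : chartBase cc 1 b = chartBase cc 1 g * chartGen cc 1 2 := reesChartBase_apply_eq_mul_chartGen cc 1 2
  rw [map_sup₃, map_add, map_mul, map_pow, ct, cb]
  exact pocketG _ _ _ _ j

set_option maxHeartbeats 400000 in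
-- instance-path defeq through `HomogeneousLocalization`'s standalone `Pow`/`Mul`
/-- **`b`-chart**: `K B = (b) · K[j](t/b, g/b, a, b)` — the controlled transform is the pocket with `j ↦ j − 1`.
[cite: StacksProject, Tag 0804] -/
theorem map_pocket_two (j : ℕ) : (Kp3[t, g, a, b, j + 1]).map (chartBase cc 2) =
    Ideal.span {chartBase cc 2 b} * Kp3[chartGen cc 2 0, chartGen cc 2 1, chartBase cc 2 a, chartBase cc 2 b, j] := by
  have ct : chartBase cc 2 t = chartBase cc 2 b * chartGen cc 2 0 := reesChartBase_apply_eq_mul_chartGen cc 2 0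
  have cg : chartBase cc 2 g = chartBase cc 2 b * chartGen cc 2 1 := reesChartBase_apply_eq_mul_chartGen cc 2 1
  rw [map_sup₃, map_add, map_mul, map_pow, ct, cg]
  exact pocketB _ _ _ _ j

end PocketCharts

/-! ## §3 STRONG END of the pocket at `j = 0` on the local rings of the `b`-chart -/

section PocketLocal

variable {R : Type u} [CommRing R] [IsRegularLocalRing R] (t g b a : R) {l : ℕ} (w : Fin l → R)
  (hz : Ideal.span (Set.range (Fin.append ![t, g, b] (Fin.cons a w : Fin (l + 1) → R))) = maximalIdeal R)
  (hd : (maximalIdeal R).spanFinrank = 3 + (l + 1))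

variable (𝔓 : Ideal (chartRing (![t, g, b] : Fin 3 → R) 2)) [𝔓.IsPrime]
  (h𝔓 : 𝔓.comap (chartBase (![t, g, b] : Fin 3 → R) 2) = maximalIdeal R)
  (L : Type u) [CommRing L] [IsLocalRing L] [Algebra (chartRing (![t, g, b] : Fin 3 → R) 2) L]
  [IsLocalization.AtPrime L 𝔓]

local notation3 "cc" => (![t, g, b] : Fin 3 → R)
local notation3 "aw" => (Fin.cons a w : Fin (l + 1) → R)
local notation3 "φL" => (algebraMap (chartRing (![t, g, b] : Fin 3 → R) 2) L :
  chartRing (![t, g, b] : Fin 3 → R) 2 →+* L)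
/-- The enumeration `(t/b, g/b)` of the chart generators other than `b/b`. -/
local notation3 "jJ" => (![⟨0, by decide⟩, ⟨1, by decide⟩] : Fin 2 → {j : Fin 3 // j ≠ 2})

omit [IsRegularLocalRing R] [𝔓.IsPrime] [IsLocalRing L] [IsLocalization.AtPrime L 𝔓] in
/-- The chart family `(b, t/b, g/b, a, w…)` of `…BlowupChartRsop`, unfolded. [folklore] -/
theorem chartFamily_pocket_eq :
    chartFamily cc 2 aw L (chartBase cc 2) (chartGen cc 2) jJ =
      Fin.cons (φL (chartBase cc 2 b)) (Fin.append ![φL (chartGen cc 2 0), φL (chartGen cc 2 1)]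
        fun k => φL (chartBase cc 2 (aw k))) := by
  have hf : (fun k : Fin 2 => φL (chartGen cc 2 (jJ k).1)) = ![φL (chartGen cc 2 0), φL (chartGen cc 2 1)] := by
    funext k
    fin_cases k <;> rfl
  unfold chartFamily
  rw [← hf]
  rfl

include hz hd h𝔓 in
/-- [OURS · L1 W5.2 · (β-AX) Phase C · N3-pocket] **STRONG END at `j = 0`.** `R` regular local with regular system of
parameters `(t, g, b, a, w…)`; at a prime `𝔓` of the `b`-chart of `Bl_{(t,g,b)} Spec R` over `𝔪_R` containing `t/b` and
`g/b` (the points of the last pocket `(t′) + (g′) + (g′ + a)`), the members `b`, `t/b`, BOTH hosts `g/b`, `g/b + a` and the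
remaining parameters `w…` form part of ONE regular system of parameters of `L = B_𝔓` — the strong END of the run
(currency of RULING G11-14). [cite: DeJong1996, 2.4] [cite: StacksProject, Tag 0BIQ] -/
theorem isRsopPart_pocket_end (h0 : chartGen cc 2 0 ∈ 𝔓) (h1 : chartGen cc 2 1 ∈ 𝔓) :
    IsRsopPart (Fin.cons (φL (chartBase cc 2 b))
      (Fin.append ![φL (chartGen cc 2 0), φL (chartGen cc 2 1)]
        (Fin.cons (φL (chartGen cc 2 1) + φL (chartBase cc 2 a)) fun k => φL (chartBase cc 2 (w k)) :
          Fin (l + 1) → L))) := by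
  have hrsop := isRsopPart_chartFamily_reesChart cc 2 aw hz hd 𝔓 h𝔓 L jJ
    (fun i j hij => by fin_cases i <;> fin_cases j <;> simp_all) (fun k => by fin_cases k <;> assumption)
  rw [chartFamily_pocket_eq] at hrsop
  refine hrsop.of_span_range_eq ?_
  have ha : (fun k : Fin (l + 1) => φL (chartBase cc 2 (aw k))) =
      Fin.cons (φL (chartBase cc 2 a)) (fun k => φL (chartBase cc 2 (w k))) := by
    funext k
    refine Fin.cases rfl (fun k => ?_) k
    rfl
  rw [ha]
  simp only [Fin.range_cons, range_fin_append, Matrix.range_cons, Matrix.range_empty, Set.union_empty,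
    Set.singleton_union, Ideal.span_insert, Ideal.span_union]
  -- exchange `g′ + a` for `a` in the presence of `g′`
  congr 1
  rw [← sup_assoc, ← sup_assoc]
  congr 1
  exact sup_span_singleton_congr (by
    rw [add_sub_cancel_right]; exact Ideal.mem_sup_right (Ideal.mem_span_singleton_self _))

end PocketLocal

end DepthPhaseCRuns

end Summit.ResolutionOfSingularities.ResolutionOfSingularities.Theorems

end
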